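import Summits.KontsevichZagierPeriods.KontsevichZagierPeriods.Theses.LowDimension
import Summits.KontsevichZagierPeriods.KontsevichZagierPeriods.Theorems.KzOnePeriodsRungsOfSummit
import Literature.NumberTheory.Transcendental.KZRelationsLE
import Literature.NumberTheory.Transcendental.KZCalculusProofs

/-!
# KontsevichZagierPeriods — the dimension ladder `KZ_le d`, `KZ_leLE d`, `KZ_leRat d`, `P_le d`

Cell pub-kz1p (paper "KZ 1-periods"), seat b2b-kz1p-1; LEAN-IN-TREE migration (human rule 2026-08-18) of the cell's staging
module `KzOnePeriods/Ladder.lean`.  The LADDER is the object proposed by seat free-KontsevichZagierPeriods-1 (ideation tier,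
2026-08-17; credit): inside the formal period group `FormalRep ⧸ relations` of the tree's calculus of moves
(`Literature.NumberTheory.Transcendental.KZCalculus`; as a ring it is `KZ.FormalPeriodRing`, `KZRulesAssociator.lean`), the
subgroup `P_≤d` generated by the classes of representations of dimension `≤ d`, and the rung statement

  `KZ_≤d : ∀ r r' of dimensions ≤ d, value r = value r' → KZ.Equivalent r r'`.

What the tree already PROVES about the rungs (all elsewhere, cited by name, nothing re-proved here): rung 0 is the closed
item `Theses.LowDimension.LowdimDimZero` (`LowDimension.LowdimDimZero.lowdimDimZero_proof`); the rational-shape rung 1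
`KZ_leRat 1` is the closed item `Theses.LowDimension.LowdimBaker0DimLeOne` (Baker; `lowdimBaker0DimLeOne_proof`); rung 1 for
ALL semialgebraic representations follows from the tree's rendering of Huber–Wüstholz (`kz_le_one_of_huberWustholzCurvePeriods`,
`Theorems/KzOnePeriodsRungOneOfHW.lean`); the summit implies every rung (`kz_le_of_summit`, `Theorems/KzOnePeriodsRungsOfSummit.lean`).
Rung 2 contains the open crux `Theses.LowDimension.PlanarAreas` (item stmt-KontsevichZagierPeriods-4990) as the
integrand-`1` special case (`planarAreas_of_KZ_le_two` below).

This file: the three rung predicates, their monotonicity and comparison, the identification of the route items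
`LowdimThesis` / `LowdimBaker0DimLeOne` with `∀ d, KZ_leRat d` / `KZ_leRat 1` (definitional), `summit ↔ ∀ d, KZ_le d`, the
filtration `P_le d` and the KERNEL FORM `KerOn_le d` of rung `d` ("evaluation is injective on `P_≤d`", free-KZ-1) with
`KZ_le_of_kerOn_le`.  Two codomains, because the cell's referee (R0-4) asks for the TRUNCATED one: `KZ_le d` concludes
`KZ.Equivalent` (moves in any ambient dimension), `KZ_leLE d` concludes `KZ.EquivalentLE d` (moves among representations of
dimension `≤ d` only, `KZRelationsLE.lean`); `KZ_leLE d → KZ_le d`, and `KZ_leLE 1` is OPEN even given Huber–Wüstholz (the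
tree's realisation of the curve relators passes through 2-dimensional regions).

Sources: M. Kontsevich, D. Zagier, *Periods* (2001), §1.1 Definition, §1.2 rules (1)–(3), Conjecture 1, Problem 2 ("the
dimension of the integral"); free-KontsevichZagierPeriods-1, IDEAS.md / MEMO.md (2026-08-17).  No transcendence input.
[cite: KontsevichZagier2001, §1.2]
-/

noncomputable section

namespace Summit.KontsevichZagierPeriods.KzOnePeriods

open Literature.NumberTheory.Transcendental
open Literature.NumberTheory.Transcendental.KZ
open Summit.KontsevichZagierPeriods.KontsevichZagierPeriods.Theses

/-! ### Rung statements -/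

/-- **`KZ_≤d`** (free-KZ-1's rung `d`): two integral representations of dimensions `n, m ≤ d` (ℚ-semialgebraic
integrands, the tree's `KZ.IntegralRep`) with the same value are KZ-equivalent.  [Kontsevich–Zagier 2001, §1.2
Conjecture 1, restricted by "the dimension of the integral" of §1.2 Problem 2] [cite: KontsevichZagier2001, §1.2] -/
def KZ_le (d : ℕ) : Prop :=
  ∀ ⦃n m : ℕ⦄, n ≤ d → m ≤ d → ∀ (r : IntegralRep n) (r' : IntegralRep m),
    r.value = r'.value → Equivalent r r'

/-- **`KZ_≤d` in the truncated calculus**: as `KZ_le d`, but the moves are confined to representations of dimension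
`≤ d` (`KZ.EquivalentLE d`, i.e. `[r] − [r'] ∈ KZ.relationsLE d`).  Implies `KZ_le d` (`KZ_le_of_KZ_leLE`).
[Kontsevich–Zagier 2001, §1.2; truncation = `KZRelationsLE.lean`] [cite: KontsevichZagier2001, §1.2] -/
def KZ_leLE (d : ℕ) : Prop :=
  ∀ ⦃n m : ℕ⦄, n ≤ d → m ≤ d → ∀ (r : IntegralRep n) (r' : IntegralRep m),
    r.value = r'.value → EquivalentLE d r r'

/-- **`KZ_≤d` for KZ's literal rational shape** (`KZ.IntegralRep.IsRational`: integrand `p/q`, `p, q ∈ ℚ[x]`), the shape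
quantified in the summit statement.  For `d = 1` this is, definitionally, the route item `LowDimension.LowdimBaker0DimLeOne`
(proved in the tree). [Kontsevich–Zagier 2001, §1.1 Definition, §1.2 Conjecture 1] [cite: KontsevichZagier2001, §1.2] -/
def KZ_leRat (d : ℕ) : Prop :=
  ∀ ⦃n m : ℕ⦄, n ≤ d → m ≤ d → ∀ (r : IntegralRep n) (r' : IntegralRep m),
    r.IsRational → r'.IsRational → r.value = r'.value → Equivalent r r'

/-! ### Elementary relations between the rungs -/

variable {d d' : ℕ}

/-- Truncated rung ⇒ rung. [cite: KontsevichZagier2001, §1.2] -/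
theorem KZ_le_of_KZ_leLE (h : KZ_leLE d) : KZ_le d :=
  fun _ _ hn hm r r' hv => (h hn hm r r' hv).equivalent

/-- Rung ⇒ rational rung. [cite: KontsevichZagier2001, §1.2] -/
theorem KZ_leRat_of_KZ_le (h : KZ_le d) : KZ_leRat d :=
  fun _ _ hn hm r r' _ _ hv => h hn hm r r' hv

/-- The rungs decrease along the ladder: `KZ_≤d' → KZ_≤d` for `d ≤ d'`. [cite: KontsevichZagier2001, §1.2] -/
theorem KZ_le_mono (hd : d ≤ d') (h : KZ_le d') : KZ_le d :=
  fun _ _ hn hm r r' hv => h (hn.trans hd) (hm.trans hd) r r' hv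

/-- Same for the rational rungs. [cite: KontsevichZagier2001, §1.2] -/
theorem KZ_leRat_mono (hd : d ≤ d') (h : KZ_leRat d') : KZ_leRat d :=
  fun _ _ hn hm r r' hr hr' hv => h (hn.trans hd) (hm.trans hd) r r' hr hr' hv

/-- Same for the truncated rungs (`relationsLE` is monotone in `d`). [cite: KontsevichZagier2001, §1.2] -/
theorem KZ_leLE_mono (hd : d ≤ d') (h : KZ_leLE d) :
    ∀ ⦃n m : ℕ⦄, n ≤ d → m ≤ d → ∀ (r : IntegralRep n) (r' : IntegralRep m),
      r.value = r'.value → EquivalentLE d' r r' :=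
  fun _ _ hn hm r r' hv => (h hn hm r r' hv).mono hd

/-! ### The route items of `LowDimension` on the ladder (definitional identifications) -/

/-- The frame item `LowDimension.LowdimThesis` IS `∀ d, KZ_leRat d`. [cite: KontsevichZagier2001, §1.2] -/
theorem lowdimThesis_iff_forall_KZ_leRat : LowDimension.LowdimThesis ↔ ∀ d, KZ_leRat d := Iff.rfl

/-- The closed item `LowDimension.LowdimBaker0DimLeOne` IS `KZ_leRat 1` (so `KZ_leRat 1` is a theorem of the tree:
`LowDimension.LowdimBaker0DimLeOne.lowdimBaker0DimLeOne_proof`, from Baker). [cite: KontsevichZagier2001, §1.2] -/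
theorem lowdimBaker0DimLeOne_iff_KZ_leRat_one : LowDimension.LowdimBaker0DimLeOne ↔ KZ_leRat 1 := Iff.rfl

/-- The closed item `LowDimension.LowdimDimZero` is rung `0`. [cite: KontsevichZagier2001, §1.2] -/
theorem lowdimDimZero_iff_KZ_le_zero : LowDimension.LowdimDimZero ↔ KZ_le 0 := by
  constructor
  · intro h n m hn hm r r' hv
    obtain rfl : n = 0 := Nat.le_zero.mp hn
    obtain rfl : m = 0 := Nat.le_zero.mp hm
    exact h r r' hv
  · intro h r r' hv
    exact h le_rfl le_rfl r r' hv

/-- The open crux `LowDimension.PlanarAreas` (item stmt-KontsevichZagierPeriods-4990) is the integrand-`1` special case of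
rung `2`. [cite: KontsevichZagier2001, §1.2] -/
theorem planarAreas_of_KZ_le_two (h : KZ_le 2) : LowDimension.PlanarAreas :=
  fun r r' _ _ hv => h le_rfl le_rfl r r' hv

/-! ### The summit and the ladder -/

/-- The summit gives every rational rung (specialisation). [cite: KontsevichZagier2001, §1.2] -/
theorem KZ_leRat_of_summit (h : _root_.KontsevichZagierPeriods) (d : ℕ) : KZ_leRat d :=
  fun _ _ _ _ r r' hr hr' hv => (_root_.KontsevichZagierPeriods_iff).1 h r r' hr hr' hv

/-- Conversely every pair of rational representations lies on some rung. [cite: KontsevichZagier2001, §1.2] -/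
theorem summit_of_forall_KZ_leRat (h : ∀ d, KZ_leRat d) : _root_.KontsevichZagierPeriods :=
  (_root_.KontsevichZagierPeriods_iff).2 fun n m r r' hr hr' hv =>
    h (max n m) (le_max_left n m) (le_max_right n m) r r' hr hr' hv

/-- **On-path lemma `S ⇒ KZ_≤d`** for ALL semialgebraic representations — the landed
`kz_le_of_summit` (rational-shape detour inside the calculus), restated over `KZ_le`. [cite: KontsevichZagier2001, §1.2] -/
theorem KZ_le_of_summit (h : _root_.KontsevichZagierPeriods) (d : ℕ) : KZ_le d := kz_le_of_summit h d

/-- The summit is equivalent to "all rungs" … [cite: KontsevichZagier2001, §1.2] -/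
theorem summit_iff_forall_KZ_le : _root_.KontsevichZagierPeriods ↔ ∀ d, KZ_le d :=
  ⟨fun h d => KZ_le_of_summit h d, fun h => summit_of_forall_KZ_leRat fun d => KZ_leRat_of_KZ_le (h d)⟩

/-- … and to "all rational rungs", i.e. to the frame item `LowdimThesis`. [cite: KontsevichZagier2001, §1.2] -/
theorem summit_iff_forall_KZ_leRat : _root_.KontsevichZagierPeriods ↔ ∀ d, KZ_leRat d :=
  ⟨KZ_leRat_of_summit, summit_of_forall_KZ_leRat⟩

/-! ### The filtration `P_≤d ⊆ FormalRep ⧸ relations` (free-KZ-1) and the kernel form of the rungs -/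

/-- **`P_≤d`** (free-KZ-1): the subgroup of the formal period group `FormalRep ⧸ relations` generated by the classes of
representations of dimension `≤ d` — the image of the tree's `KZ.formalRepLE d`. [cite: KontsevichZagier2001, §1.2] -/
def P_le (d : ℕ) : AddSubgroup (FormalRep ⧸ relations) := (formalRepLE d).map (QuotientAddGroup.mk' relations)

/-- `P_≤d` is increasing in `d`. [cite: KontsevichZagier2001, §1.2] -/
theorem P_le_mono (hd : d ≤ d') : P_le d ≤ P_le d' := AddSubgroup.map_mono (formalRepLE_mono hd)

/-- The class of a representation of dimension `≤ d` lies in `P_≤d`. [cite: KontsevichZagier2001, §1.2] -/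
theorem mk_of_mem_P_le {n : ℕ} (r : IntegralRep n) (hn : n ≤ d) :
    QuotientAddGroup.mk' relations (of r) ∈ P_le d :=
  ⟨of r, AddSubgroup.subset_closure ⟨n, r, hn, rfl⟩, rfl⟩

/-- **Kernel form of rung `d`** (free-KZ-1: "evaluation is injective on `P_≤d`", stated on representatives, so that no
descended evaluation map is needed): a formal combination generated in dimension `≤ d` that evaluates to `0` is a
relation. [cite: KontsevichZagier2001, §1.2] -/
def KerOn_le (d : ℕ) : Prop := ∀ x ∈ formalRepLE d, eval x = 0 → x ∈ relations

/-- The kernel form decreases along the ladder. [cite: KontsevichZagier2001, §1.2] -/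
theorem KerOn_le_mono (hd : d ≤ d') (h : KerOn_le d') : KerOn_le d :=
  fun x hx h0 => h x (formalRepLE_mono hd hx) h0

/-- The kernel form implies the pair form of rung `d` (`[r] − [r']` is generated in dimension `≤ d` and evaluates to
`value r − value r'`). [cite: KontsevichZagier2001, §1.2] -/
theorem KZ_le_of_kerOn_le (h : KerOn_le d) : KZ_le d := by
  intro n m hn hm r r' hv
  refine h (of r - of r') ?_ ?_
  · exact (formalRepLE d).sub_mem (AddSubgroup.subset_closure ⟨n, r, hn, rfl⟩)
      (AddSubgroup.subset_closure ⟨m, r', hm, rfl⟩)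
  · rw [map_sub, eval_of, eval_of, hv, sub_self]

/-- In `FormalRep ⧸ relations`: `KZ.Equivalent r r'` iff the classes agree. [cite: KontsevichZagier2001, §1.2] -/
theorem equivalent_iff_mk_eq {n m : ℕ} (r : IntegralRep n) (r' : IntegralRep m) :
    Equivalent r r' ↔ QuotientAddGroup.mk' relations (of r) = QuotientAddGroup.mk' relations (of r') := by
  rw [← sub_eq_zero, ← map_sub]
  exact (QuotientAddGroup.eq_zero_iff (of r - of r')).symm

end Summit.KontsevichZagierPeriods.KzOnePeriods
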